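import Literature.MathematicalPhysics.QuantumFieldTheory.Balaban1983to89.B4Eq19LatticeHarmonicDecay
import Literature.MathematicalPhysics.QuantumFieldTheory.Balaban1983to89.B4Eq19LatticeBoxMeans

/-!
# `Balaban1983to89.B4Eq19LatticeGradientExcessDecay` — T. Bałaban, *Propagators and renormalization transformations for lattice gauge theories. II*,
# Commun. Math. Phys. **96** (1984) 223–250 [Balaban1984PropagatorsII] (1.9) p. 226, with *Propagators for lattice gauge theories in a background
# field*, Commun. Math. Phys. **99** (1985) 389–434 [Balaban1985BackgroundPropagators] Thm 3.1 (3.43)₁∕(3.44) p. 398 (the GRADIENT members): **CAMPANATO's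
# EXCESS DECAY WITH EXPONENT `d + 2` FOR THE GRADIENT OF A LATTICE-HARMONIC FUNCTION ON `ℤ^d`** — for `−Δh = 0` on `Q_{r+1}(z)` and `0 ≤ ρ ≤ r`,
# `exc (∂_μh) (Q_ρ(z)) ≤ A₁(d)·((ρ+1)∕(r+1))^{d+2}·exc (∂_μh) (Q_r(z))` ([Giaquinta1984] Ch. III §3 (3.3) p. 85, the constant-coefficient step of the `C^{1,γ}`
# theory, discrete): the key input of the gradient Campanato iteration `B4Eq19LatticeGradientCampanato`.

statement-level skeleton of published theorems with citation tags; proofs where landed; nothing here is a claim about the Yang–Mills mass gap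

CITATION HEADER (lean-in-tree rule).  Audit cell `pub-balaban`, sub-cell `t4`, BINDER row NE9; filed by NE9 crux-team LEAF PROVER 01
(`b2b-balaban-t4-ne9-formalise-leaf-01`, gen 95; bears_on: R4/N22).  The CONTENT is [folklore] discrete elliptic regularity ([Giaquinta1984] Ch. III §2–3:
Caccioppoli + sup bound + energy decay ⇒ excess decay); [Balaban1984PropagatorsII] (1.9) ∕ [Balaban1985BackgroundPropagators] (3.43)₁, (3.44) are the printed
statements these files serve, nothing of them is asserted here.  REUSED BY NAME: gen 94's `B4Eq19LatticeHarmonicDecay.sq_fdiff_le_of_harmonic` (sup bound),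
`harmonic_decay` (energy decay), `B4Eq19LatticeCaccioppoli.caccioppoli_harmonic`, `B4Eq19LatticeOperators.lop_fdiff_eq_zero`; this lineage's
`B4Eq19LatticeBoxMeans` (`exc`, `exc_le_sum_sq_sub`, `exc_mono`, `abs_sub_le_of_fdiff_bound`).

WHAT IS PROVED (sorry-free; proof lane — 0 `def`; [folklore]).
* `gradSq_sub_const` — `gradSq (v − c) = gradSq v`.
* `exc_le_of_harmonic_small` — the SMALL-RADIUS chain at `κ = 0`: for `v` harmonic on `Q_r(z)`, `ρ ≥ 0` and `(12d+8)(ρ+1) ≤ r+1`: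
  `exc v (Q_ρ) ≤ [4^d d²(1+56d)^d · A_d · 896d(12d+8)^d]·((ρ+1)∕(r+1))^{d+2}·exc v (Q_r)` (`exc ≤ Σ|v − v(z)|²` ≤ lattice paths × the sup bound on
  `Q_{R₁}`, `R₁ = ρ + (ρ+1) + d(ρ+3)`; `harmonic_decay` from `Q_{R₁}` to `Q_s`, `s = ⌊(r−2)∕2⌋`; `caccioppoli_harmonic` for `v − avg_{Q_r}v` from `Q_s` to
  `Q_{2s+2} ⊆ Q_r` — CONSTANTS ARE HARMONIC AT `κ = 0`).
* **`gradient_excess_decay`** — for `−Δh = 0` on `Q_{r+1}(z)`, `0 ≤ ρ ≤ r`, every `μ`: `exc (fdiff μ h) z ρ ≤ A₁·((ρ+1)∕(r+1))^{d+2}·exc (fdiff μ h) z r`,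
  `A₁ = 4^d d²(1+56d)^d·A_d·896d(12d+8)^d + (12d+8)^{d+2}`, `A_d = 2^d(1+56d)^d(8(d+1))^{d+1}` (`∂_μh` is harmonic on `Q_r(z)`; small radii by the chain,
  comparable radii by `exc_mono`).
HONEST SCOPE.  [folklore] lattice analysis; constants crude; no estimate of print; NOT summit progress (cell pub-balaban: NE9 NOT PRINTED ∕ NOT PROVED; spine
PROVED 0∕9; finite T⁴ — NOT infinite volume, NOT mass gap, NOT BetaPertH, NOT Clay).  NEW file importing `B4Eq19LatticeHarmonicDecay`, `B4Eq19LatticeBoxMeans`.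
Net new unproved facts: 0.
-/

noncomputable section

open scoped BigOperators
open Finset

namespace Literature.MathematicalPhysics.QuantumFieldTheory.Balaban1983to89.B4Eq19LatticeGradientExcessDecay

open B4Eq19LatticeOperators B4Eq19LatticeCaccioppoli B4Eq19LatticeHarmonicDecay B4Eq19LatticeBoxMeans

variable {d : ℕ}

/-! ## §1 Two small lemmas -/

/-- `gradSq` does not see constants. [folklore] [cite: Giaquinta1984, Ch. III §2 p.77] -/
theorem gradSq_sub_const (v : Zd d → ℝ) (c : ℝ) (Q : Finset (Zd d)) : gradSq (fun y => v y - c) Q = gradSq v Q := by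
  rw [gradSq_def, gradSq_def]
  refine Finset.sum_congr rfl fun y _ => Finset.sum_congr rfl fun μ _ => ?_
  rw [fdiff_apply, fdiff_apply]; ring

/-- At `κ = 0` constants are harmonic: `−Δ(v − c) = −Δv`. [folklore] [cite: Giaquinta1984, Ch. III §2 p.78] -/
theorem lop_zero_sub_const (v : Zd d → ℝ) (c : ℝ) (y : Zd d) : lop 0 (fun x => v x - c) y = lop 0 v y := by
  rw [lop_apply, lop_apply]; simp; ring

/-! ## §2 The small-radius chain -/

/-- **THE SMALL-RADIUS CHAIN** (`κ = 0`): for `v` harmonic on `Q_r(z)`, `0 ≤ ρ` and `(12d+8)(ρ+1) ≤ r+1`,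
`exc v (Q_ρ(z)) ≤ [4^d d²(1+56d)^d·A_d·896d(12d+8)^d]·((ρ+1)∕(r+1))^{d+2}·exc v (Q_r(z))`. [folklore]
[cite: Giaquinta1984, Ch. III §3 (3.3) p.85, §2 (2.5) p.78] -/
theorem exc_le_of_harmonic_small {z : Zd d} {ρ r : ℤ} (hρ : 0 ≤ ρ) (hsmall : (12 * (d : ℤ) + 8) * (ρ + 1) ≤ r + 1) (v : Zd d → ℝ)
    (hv : ∀ y ∈ box z r, lop 0 v y = 0) :
    exc v z ρ ≤ ((4 : ℝ) ^ d * d ^ 2 * (1 + 56 * d) ^ d * ((2 : ℝ) ^ d * (1 + 56 * d) ^ d * (8 * ((d : ℝ) + 1)) ^ (d + 1)) *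
      (896 * d * (12 * (d : ℝ) + 8) ^ d)) * (((ρ : ℝ) + 1) / ((r : ℝ) + 1)) ^ (d + 2) * exc v z r := by
  -- constants
  set D : ℝ := (2 : ℝ) ^ d * (1 + 56 * d) ^ d with hD
  set A : ℝ := (2 : ℝ) ^ d * (1 + 56 * d) ^ d * (8 * ((d : ℝ) + 1)) ^ (d + 1) with hA
  have hdR : (0 : ℝ) ≤ d := Nat.cast_nonneg d
  have hD0 : 0 ≤ D := by positivity
  have hA0 : 0 ≤ A := by positivity
  -- the radii
  set ℓ : ℕ := ρ.toNat + 1 with hℓ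
  have hℓZ : (ℓ : ℤ) = ρ + 1 := by rw [hℓ]; push_cast; rw [Int.toNat_of_nonneg hρ]
  have hℓ1 : 1 ≤ ℓ := by omega
  set R₁ : ℤ := ρ + ℓ + d * ((ℓ : ℤ) + 2) with hR₁
  set s : ℤ := (r - 2) / 2 with hs
  have hd0 : (0 : ℤ) ≤ d := Nat.cast_nonneg d
  have hdρ : (0 : ℤ) ≤ (d : ℤ) * ρ := mul_nonneg hd0 hρ
  have h8 : (8 : ℤ) ≤ (12 * (d : ℤ) + 8) * (ρ + 1) := by linarith
  have hr20 : 8 ≤ r + 1 := h8.trans hsmall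
  have hs1 : 2 * s ≤ r - 2 := by rw [hs]; omega
  have hs2 : r - 3 ≤ 2 * s := by rw [hs]; omega
  have hR₁eq : R₁ + 1 = (d + 2) * (ρ + 1) + 2 * d := by rw [hR₁, hℓZ]; ring
  have hR₁le : R₁ + 1 ≤ (3 * d + 2) * (ρ + 1) := by rw [hR₁eq]; linarith
  have hs4 : r + 1 ≤ 4 * (s + 1) := by linarith
  have hR₁s : R₁ ≤ s := by linarith
  have hR₁0 : 0 ≤ R₁ := by rw [hR₁]; positivity
  have hs0 : 1 ≤ s := by linarith
  have hsr : s + 1 ≤ r := by linarith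
  -- harmonicity on the sub-boxes
  have hvR : ∀ y ∈ box z (ρ + ℓ + d * ((ℓ : ℤ) + 2) + 1), lop 0 v y = 0 := fun y hy =>
    hv y (box_mono z (by rw [← hR₁]; linarith) hy)
  have hvs : ∀ y ∈ box z (s + 1), lop 0 v y = 0 := fun y hy => hv y (box_mono z hsr hy)
  -- (2)–(5): the excess on `Q_ρ` by the sup bound on `Q_{R₁}`
  set G : ℝ := gradSq v (box z R₁) with hG
  have hG0 : 0 ≤ G := gradSq_nonneg _ _
  have hℓR : ((ℓ : ℝ) + 1) = (ρ : ℝ) + 2 := by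
    have : ((ℓ : ℤ) : ℝ) = (ρ : ℝ) + 1 := by rw [hℓZ]; push_cast; ring
    push_cast at this; linarith
  have hℓpos : (0 : ℝ) < (ℓ : ℝ) + 1 := by positivity
  set S : ℝ := Real.sqrt (D / ((ℓ : ℝ) + 1) ^ d * G) with hSdef
  have hS0 : 0 ≤ S := Real.sqrt_nonneg _
  have hSsq : S ^ 2 = D / ((ℓ : ℝ) + 1) ^ d * G := Real.sq_sqrt (by positivity)
  have hsup : ∀ y ∈ box z ρ, ∀ ν, |fdiff ν v y| ≤ S := by
    intro y hy ν
    apply Real.abs_le_sqrt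
    have := sq_fdiff_le_of_harmonic (le_refl (0 : ℝ)) hℓ1 hρ v hvR hy ν
    rw [hD]; exact this
  have hρR : (0 : ℝ) ≤ ρ := by exact_mod_cast hρ
  have hpath : ∀ y ∈ box z ρ, (v y - v z) ^ 2 ≤ (d : ℝ) ^ 2 * (ρ : ℝ) ^ 2 * (D / ((ℓ : ℝ) + 1) ^ d * G) := by
    intro y hy
    have h := abs_sub_le_of_fdiff_bound v hS0 hsup hy
    calc (v y - v z) ^ 2 = |v y - v z| ^ 2 := (sq_abs _).symm
      _ ≤ ((d : ℝ) * ρ * S) ^ 2 := pow_le_pow_left₀ (abs_nonneg _) h 2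
      _ = (d : ℝ) ^ 2 * (ρ : ℝ) ^ 2 * (D / ((ℓ : ℝ) + 1) ^ d * G) := by rw [← hSsq]; ring
  have hexcρ : exc v z ρ ≤ (4 : ℝ) ^ d * d ^ 2 * (1 + 56 * d) ^ d * ((ρ : ℝ) + 1) ^ 2 * G := by
    have hcard := card_box z hρ
    have hratio : ((2 * ρ + 1 : ℤ) : ℝ) ^ d / ((ℓ : ℝ) + 1) ^ d ≤ (2 : ℝ) ^ d := by
      rw [div_le_iff₀ (by positivity), ← mul_pow]
      apply pow_le_pow_left₀ (by push_cast; linarith)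
      push_cast; rw [hℓR]; linarith
    calc exc v z ρ ≤ ∑ y ∈ box z ρ, (v y - v z) ^ 2 := exc_le_sum_sq_sub v z ρ (v z)
      _ ≤ ∑ y ∈ box z ρ, (d : ℝ) ^ 2 * (ρ : ℝ) ^ 2 * (D / ((ℓ : ℝ) + 1) ^ d * G) := Finset.sum_le_sum hpath
      _ = ((2 * ρ + 1 : ℤ) : ℝ) ^ d * ((d : ℝ) ^ 2 * (ρ : ℝ) ^ 2 * (D / ((ℓ : ℝ) + 1) ^ d * G)) := by
          rw [Finset.sum_const, nsmul_eq_mul, hcard]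
      _ = (((2 * ρ + 1 : ℤ) : ℝ) ^ d / ((ℓ : ℝ) + 1) ^ d) * ((d : ℝ) ^ 2 * (ρ : ℝ) ^ 2 * D * G) := by
          rw [div_eq_mul_inv]; ring
      _ ≤ (2 : ℝ) ^ d * ((d : ℝ) ^ 2 * ((ρ : ℝ) + 1) ^ 2 * D * G) := by
          apply mul_le_mul hratio _ (by positivity) (by positivity)
          have h3 : (ρ : ℝ) ^ 2 ≤ ((ρ : ℝ) + 1) ^ 2 := by nlinarith
          have h2 : 0 ≤ (d : ℝ) ^ 2 * (D * G) := by positivity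
          calc (d : ℝ) ^ 2 * (ρ : ℝ) ^ 2 * D * G = (ρ : ℝ) ^ 2 * ((d : ℝ) ^ 2 * (D * G)) := by ring
            _ ≤ ((ρ : ℝ) + 1) ^ 2 * ((d : ℝ) ^ 2 * (D * G)) := mul_le_mul_of_nonneg_right h3 h2
            _ = (d : ℝ) ^ 2 * ((ρ : ℝ) + 1) ^ 2 * D * G := by ring
      _ = (4 : ℝ) ^ d * d ^ 2 * (1 + 56 * d) ^ d * ((ρ : ℝ) + 1) ^ 2 * G := by
          rw [hD, show (4 : ℝ) ^ d = 2 ^ d * 2 ^ d by rw [← mul_pow]; norm_num]; ring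
  -- (6): energy decay from `Q_{R₁}` to `Q_s`
  have hdecay : G ≤ A * (((R₁ : ℝ) + 1) / ((s : ℝ) + 1)) ^ d * gradSq v (box z s) := by
    have := harmonic_decay (le_refl (0 : ℝ)) hR₁0 hR₁s v hvs
    rw [hG, hA]; exact this
  -- (7): Caccioppoli for `v − avg_{Q_r} v` from `Q_s` to `Q_{2s+2} ⊆ Q_r`
  set c : ℝ := boxAvg v z r with hc
  have hcacc : gradSq v (box z s) ≤ (14 * d / (s : ℝ) ^ 2) * exc v z r := by
    have hh : ∀ y ∈ box z (s + s), lop 0 (fun x => v x - c) y = 0 := fun y hy => by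
      rw [lop_zero_sub_const]; exact hv y (box_mono z (by linarith) hy)
    have h1 := caccioppoli_harmonic (le_refl (0 : ℝ)) (fun x => v x - c) z (by linarith : (0 : ℤ) ≤ s) hs0 hh
    rw [gradSq_sub_const] at h1
    refine h1.trans (mul_le_mul_of_nonneg_left ?_ (by positivity))
    calc ∑ y ∈ box z (s + s + 2), (v y - c) ^ 2 ≤ ∑ y ∈ box z r, (v y - c) ^ 2 :=
          Finset.sum_le_sum_of_subset_of_nonneg (box_mono z (by linarith)) fun _ _ _ => sq_nonneg _
      _ = exc v z r := by rw [sum_sq_sub_eq, hc, sub_self]; ring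
  -- (9): the ratios
  have hr8R : (8 : ℝ) ≤ (r : ℝ) + 1 := by exact_mod_cast hr20
  have hs1' : (1 : ℝ) ≤ s := by exact_mod_cast hs0
  have hr1 : (0 : ℝ) < (r : ℝ) + 1 := by linarith
  have hs1R : (0 : ℝ) < (s : ℝ) + 1 := by linarith
  have hsR : (0 : ℝ) < (s : ℝ) := by linarith
  have hq0 : 0 ≤ ((ρ : ℝ) + 1) / ((r : ℝ) + 1) := by positivity
  have hratio1 : ((R₁ : ℝ) + 1) / ((s : ℝ) + 1) ≤ (12 * (d : ℝ) + 8) * (((ρ : ℝ) + 1) / ((r : ℝ) + 1)) := by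
    have h1 : ((R₁ : ℝ) + 1) ≤ (3 * d + 2) * ((ρ : ℝ) + 1) := by exact_mod_cast hR₁le
    have h2 : ((r : ℝ) + 1) ≤ 4 * ((s : ℝ) + 1) := by exact_mod_cast hs4
    have h4 : (1 : ℝ) ≤ 4 * ((s : ℝ) + 1) / ((r : ℝ) + 1) := by rw [le_div_iff₀ hr1]; linarith
    have h3 : 0 ≤ (3 * d + 2) * ((ρ : ℝ) + 1) := by positivity
    rw [div_le_iff₀ hs1R]
    calc ((R₁ : ℝ) + 1) ≤ (3 * d + 2) * ((ρ : ℝ) + 1) * 1 := by rw [mul_one]; exact h1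
      _ ≤ (3 * d + 2) * ((ρ : ℝ) + 1) * (4 * ((s : ℝ) + 1) / ((r : ℝ) + 1)) := mul_le_mul_of_nonneg_left h4 h3
      _ = (12 * (d : ℝ) + 8) * (((ρ : ℝ) + 1) / ((r : ℝ) + 1)) * ((s : ℝ) + 1) := by
          rw [div_eq_mul_inv, div_eq_mul_inv]; ring
  have hratio2 : 14 * d / (s : ℝ) ^ 2 ≤ 896 * d / ((r : ℝ) + 1) ^ 2 := by
    have h1 : ((r : ℝ) + 1) ≤ 8 * (s : ℝ) := by
      have : r + 1 ≤ 8 * s := by linarith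
      exact_mod_cast this
    have h2 : ((r : ℝ) + 1) ^ 2 ≤ 64 * (s : ℝ) ^ 2 :=
      calc ((r : ℝ) + 1) ^ 2 ≤ (8 * (s : ℝ)) ^ 2 := pow_le_pow_left₀ hr1.le h1 2
        _ = 64 * (s : ℝ) ^ 2 := by ring
    have hs2ne : (s : ℝ) ^ 2 ≠ 0 := by positivity
    calc 14 * d / (s : ℝ) ^ 2 = 896 * d / (64 * (s : ℝ) ^ 2) := by
          rw [div_eq_div_iff hs2ne (by positivity)]; ring
      _ ≤ 896 * d / ((r : ℝ) + 1) ^ 2 := div_le_div_of_nonneg_left (by positivity) (by positivity) h2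
  have hpow : (((R₁ : ℝ) + 1) / ((s : ℝ) + 1)) ^ d ≤ (12 * (d : ℝ) + 8) ^ d * (((ρ : ℝ) + 1) / ((r : ℝ) + 1)) ^ d := by
    rw [← mul_pow]; exact pow_le_pow_left₀ (by positivity) hratio1 d
  -- assemble
  set X : ℝ := ((ρ : ℝ) + 1) / ((r : ℝ) + 1) with hX
  set C₁ : ℝ := (4 : ℝ) ^ d * d ^ 2 * (1 + 56 * d) ^ d with hC₁
  have hC₁0 : 0 ≤ C₁ := by positivity
  have hexcr : 0 ≤ exc v z r := exc_nonneg _ _ _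
  have hE0 : 0 ≤ 896 * d / ((r : ℝ) + 1) ^ 2 * exc v z r := by positivity
  have hG2 : G ≤ A * ((12 * (d : ℝ) + 8) ^ d * X ^ d) * (896 * d / ((r : ℝ) + 1) ^ 2 * exc v z r) := by
    have step1 : G ≤ A * (((R₁ : ℝ) + 1) / ((s : ℝ) + 1)) ^ d * (14 * d / (s : ℝ) ^ 2 * exc v z r) :=
      hdecay.trans (mul_le_mul_of_nonneg_left hcacc (by positivity))
    have step2 : 14 * d / (s : ℝ) ^ 2 * exc v z r ≤ 896 * d / ((r : ℝ) + 1) ^ 2 * exc v z r :=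
      mul_le_mul_of_nonneg_right hratio2 hexcr
    have step3 : A * (((R₁ : ℝ) + 1) / ((s : ℝ) + 1)) ^ d ≤ A * ((12 * (d : ℝ) + 8) ^ d * X ^ d) :=
      mul_le_mul_of_nonneg_left hpow hA0
    have hL0 : 0 ≤ A * (((R₁ : ℝ) + 1) / ((s : ℝ) + 1)) ^ d := by positivity
    calc G ≤ A * (((R₁ : ℝ) + 1) / ((s : ℝ) + 1)) ^ d * (14 * d / (s : ℝ) ^ 2 * exc v z r) := step1
      _ ≤ A * (((R₁ : ℝ) + 1) / ((s : ℝ) + 1)) ^ d * (896 * d / ((r : ℝ) + 1) ^ 2 * exc v z r) :=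
          mul_le_mul_of_nonneg_left step2 hL0
      _ ≤ A * ((12 * (d : ℝ) + 8) ^ d * X ^ d) * (896 * d / ((r : ℝ) + 1) ^ 2 * exc v z r) :=
          mul_le_mul_of_nonneg_right step3 hE0
  have hsq : ((ρ : ℝ) + 1) ^ 2 / ((r : ℝ) + 1) ^ 2 = X ^ 2 := by rw [hX, div_pow]
  calc exc v z ρ ≤ C₁ * ((ρ : ℝ) + 1) ^ 2 * G := hexcρ
    _ ≤ C₁ * ((ρ : ℝ) + 1) ^ 2 * (A * ((12 * (d : ℝ) + 8) ^ d * X ^ d) * (896 * d / ((r : ℝ) + 1) ^ 2 * exc v z r)) :=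
        mul_le_mul_of_nonneg_left hG2 (by positivity)
    _ = C₁ * A * (896 * d * (12 * (d : ℝ) + 8) ^ d) * (X ^ d * (((ρ : ℝ) + 1) ^ 2 / ((r : ℝ) + 1) ^ 2)) * exc v z r := by
        rw [mul_div_assoc]; ring
    _ = C₁ * A * (896 * d * (12 * (d : ℝ) + 8) ^ d) * X ^ (d + 2) * exc v z r := by rw [hsq, ← pow_add]

/-! ## §3 The excess decay of the gradient -/

/-- **CAMPANATO's EXCESS DECAY FOR THE GRADIENT OF A LATTICE-HARMONIC FUNCTION** (`κ = 0`): for `−Δh = 0` on `Q_{r+1}(z)`, `0 ≤ ρ ≤ r` and every direction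
`μ`, `exc (∂_μh) (Q_ρ(z)) ≤ A₁·((ρ+1)∕(r+1))^{d+2}·exc (∂_μh) (Q_r(z))` with `A₁ = 4^d d²(1+56d)^d·A_d·896d(12d+8)^d + (12d+8)^{d+2}`,
`A_d = 2^d(1+56d)^d(8(d+1))^{d+1}` (`∂_μh` is harmonic on `Q_r(z)`; small radii: `exc_le_of_harmonic_small`; comparable radii: `exc_mono`).
[folklore] [cite: Giaquinta1984, Ch. III §3 (3.3) p.85; Balaban1985BackgroundPropagators, Thm 3.1 (3.43)–(3.44) p.398] -/
theorem gradient_excess_decay {z : Zd d} {ρ r : ℤ} (hρ : 0 ≤ ρ) (hρr : ρ ≤ r) (h : Zd d → ℝ)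
    (hh : ∀ y ∈ box z (r + 1), lop 0 h y = 0) (μ : Fin d) :
    exc (fdiff μ h) z ρ ≤ ((4 : ℝ) ^ d * d ^ 2 * (1 + 56 * d) ^ d * ((2 : ℝ) ^ d * (1 + 56 * d) ^ d * (8 * ((d : ℝ) + 1)) ^ (d + 1)) *
        (896 * d * (12 * (d : ℝ) + 8) ^ d) + (12 * (d : ℝ) + 8) ^ (d + 2)) *
      (((ρ : ℝ) + 1) / ((r : ℝ) + 1)) ^ (d + 2) * exc (fdiff μ h) z r := by
  set v : Zd d → ℝ := fdiff μ h with hvdef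
  set K₁ : ℝ := (4 : ℝ) ^ d * d ^ 2 * (1 + 56 * d) ^ d * ((2 : ℝ) ^ d * (1 + 56 * d) ^ d * (8 * ((d : ℝ) + 1)) ^ (d + 1)) *
        (896 * d * (12 * (d : ℝ) + 8) ^ d) with hK₁
  set K₂ : ℝ := (12 * (d : ℝ) + 8) ^ (d + 2) with hK₂
  have hdR : (0 : ℝ) ≤ d := Nat.cast_nonneg d
  have hK₁0 : 0 ≤ K₁ := by positivity
  have hK₂0 : 0 ≤ K₂ := by positivity
  have hρR : (0 : ℝ) ≤ ρ := by exact_mod_cast hρ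
  have hrR : (ρ : ℝ) ≤ r := by exact_mod_cast hρr
  have hr1 : (0 : ℝ) < (r : ℝ) + 1 := by linarith
  have hq0 : 0 ≤ ((ρ : ℝ) + 1) / ((r : ℝ) + 1) := by positivity
  have hexcr : 0 ≤ exc v z r := exc_nonneg _ _ _
  -- `v = ∂_μ h` is harmonic on `Q_r(z)`
  have hv : ∀ y ∈ box z r, lop 0 v y = 0 := fun y hy =>
    lop_fdiff_eq_zero hh μ (box_mono z (by linarith) hy) (add_unitVec_mem_box hy μ)
  by_cases hcase : (12 * (d : ℤ) + 8) * (ρ + 1) ≤ r + 1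
  · calc exc v z ρ ≤ K₁ * (((ρ : ℝ) + 1) / ((r : ℝ) + 1)) ^ (d + 2) * exc v z r := by
          rw [hK₁]; exact exc_le_of_harmonic_small hρ hcase v hv
      _ ≤ (K₁ + K₂) * (((ρ : ℝ) + 1) / ((r : ℝ) + 1)) ^ (d + 2) * exc v z r := by
          apply mul_le_mul_of_nonneg_right (mul_le_mul_of_nonneg_right (by linarith) (by positivity)) hexcr
  · -- comparable radii
    have hbig : (r : ℝ) + 1 < (12 * (d : ℝ) + 8) * ((ρ : ℝ) + 1) := by
      have : r + 1 < (12 * (d : ℤ) + 8) * (ρ + 1) := lt_of_not_ge hcase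
      exact_mod_cast this
    have h1 : (1 : ℝ) ≤ (12 * (d : ℝ) + 8) * (((ρ : ℝ) + 1) / ((r : ℝ) + 1)) := by
      rw [mul_div_assoc', le_div_iff₀ hr1, one_mul]; exact hbig.le
    have h2 : (1 : ℝ) ≤ K₂ * (((ρ : ℝ) + 1) / ((r : ℝ) + 1)) ^ (d + 2) := by
      rw [hK₂, ← mul_pow]; exact one_le_pow₀ h1
    calc exc v z ρ ≤ exc v z r := exc_mono v z hρr
      _ = 1 * exc v z r := (one_mul _).symm
      _ ≤ K₂ * (((ρ : ℝ) + 1) / ((r : ℝ) + 1)) ^ (d + 2) * exc v z r := mul_le_mul_of_nonneg_right h2 hexcr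
      _ ≤ (K₁ + K₂) * (((ρ : ℝ) + 1) / ((r : ℝ) + 1)) ^ (d + 2) * exc v z r := by
          apply mul_le_mul_of_nonneg_right (mul_le_mul_of_nonneg_right (by linarith) (by positivity)) hexcr

end Literature.MathematicalPhysics.QuantumFieldTheory.Balaban1983to89.B4Eq19LatticeGradientExcessDecay

end
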